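import Literature.NumberTheory.GaloisRepresentations.TateLevelOneFiniteSupport
import Literature.NumberTheory.GaloisRepresentations.DecompositionGroupRelSlim
import Literature.NumberTheory.GaloisRepresentations.TateH2VanishingCorestriction
import HarnessLib

/-!
# Finite support of a class of `H²(Γ_K, ℤ/ℓ)` on the decomposition groups (explicit-cochain form)

Topic `NumberTheory/GaloisRepresentations`; namespace
`Literature.NumberTheory.GaloisRepresentations.ExplicitMuCocycles`.  Proof file: theorems only (no
definition, no instance, no named fact).

For a number field `K` and a prime `ℓ`, a locally constant `ℤ/ℓ`-valued `2`-cocycle `f` on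
`Γ_K = Gal(K̄/K)` is, for all but finitely many finite places `v`, an explicit coboundary on the
decomposition group `D_{𝔓₀(v)} ≤ Γ_K` of the prime `𝔓₀(v)` of `\bar ℤ_K` cut out by `K̄ → \bar K_v`
(`eventually_coboundaryOn_decompositionSubgroup`, `finite_setOf_not_coboundaryOn_decompositionSubgroup`):
"`α_v = 0` for almost all `v`" for `α ∈ Br(K)[ℓ] ⊇ H²(K, μ_ℓ)` (Serre, Durham §6.5 (c) (i); [NSW]
(8.1.?) / Milne ADT I.4.8), read on the subgroup `D_{𝔓₀(v)} = res_v(Γ_{K_v})` of `Γ_K`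
(Neukirch II (9.6)) rather than on `Γ_{K_v}`.  This is the instance, at the full group of a number
field, of the hypothesis (AxF) "finite support" of the abstract Neukirch lemma
(`NeukirchAbstractContainment.lean`); the passage to the open subgroups `Gal(K̄/E)` is a transport
along `Γ_E ≅ Gal(K̄/E)`.  Inputs, all from the tree: `twoCocycle_nsmul_split_levelOne_eventually`
(`TateLevelOneFiniteSupport.lean`), `decompositionSubgroup_adicCompletionPrime_eq_range`,
`absGaloisRestrict_adicCompletion_injective`, and `ℤ/ℓ ≅ (ℚ/ℤ)[ℓ]`
(`zmod_exists_addMonoidHom_addCircle`).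

Written for the abc-iut cell's GAP-LEDGER row G-L4d2g4-1 (campaign L); classical; nothing here bears
on [IUTchIII] Cor. 3.12.

## References

* J.-P. Serre, *Modular forms of weight one and Galois representations* (Durham 1977), §6.5 (c).
  [SerreDurham1977]
* J. Neukirch, *Algebraic Number Theory* (1999), Ch. II §9 Prop. (9.6). [NeukirchANT1999]
* J. Neukirch, A. Schmidt, K. Wingberg, *Cohomology of Number Fields* (2008), (8.1.17), (12.1.9).
  [NeukirchSchmidtWingberg2008]
-/

noncomputable section

open Function Field IsDedekindDomain NumberField

namespace Literature.NumberTheory.GaloisRepresentations.ExplicitMuCocycles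

open Literature.NumberTheory.GaloisRepresentations

variable (K : Type) [Field K] [NumberField K] {ℓ : ℕ} [hℓ : Fact ℓ.Prime]

/-- **Transport of an explicit splitting from `Γ_{K_v}` to the decomposition group `D_{𝔓₀(v)}`.**
If the `(ℚ/ℤ)`-image `e' ∘ f` of a `ℤ/ℓ`-valued `2`-cochain `f` on `Γ_K` splits on `Γ_{K_v}` with a
locally constant `ℓ`-torsion cochain (along `res_v`), then `f` is an explicit coboundary on
`D_{𝔓₀(v)} = res_v(Γ_{K_v})` (`res_v` is a homeomorphism onto its image).
[cite: NeukirchANT1999, Ch. II §9 Prop. (9.6)] -/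
theorem coboundaryOn_decompositionSubgroup_of_split (v : HeightOneSpectrum (𝓞 K))
    (e' : ZMod ℓ →+ AddCircle (1 : ℚ)) (he' : Injective e')
    (he'surj : ∀ x : AddCircle (1 : ℚ), ℓ • x = 0 → ∃ k : ZMod ℓ, e' k = x)
    (f : absoluteGaloisGroup K → absoluteGaloisGroup K → ZMod ℓ)
    (β : absoluteGaloisGroup (v.adicCompletion K) → AddCircle (1 : ℚ)) (hβ : IsLocallyConstant β)
    (hβf : ∀ σ τ, e' (f (absGaloisRestrict K (v.adicCompletion K) σ)
        (absGaloisRestrict K (v.adicCompletion K) τ)) + β (σ * τ) = β σ + β τ)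
    (hβℓ : ∀ σ, ℓ • β σ = 0) :
    ∃ γ : absoluteGaloisGroup K → ZMod ℓ,
      IsLocallyConstant (fun s : ↥((adicCompletionPrime K v).decompositionSubgroup (absoluteGaloisGroup K)) =>
        γ s) ∧
      ∀ a ∈ (adicCompletionPrime K v).decompositionSubgroup (absoluteGaloisGroup K),
        ∀ b ∈ (adicCompletionPrime K v).decompositionSubgroup (absoluteGaloisGroup K),
          f a b = γ a + γ b - γ (a * b) := by
  classical
  haveI : CharZero (v.adicCompletion K) :=
    charZero_of_injective_algebraMap (algebraMap K (v.adicCompletion K)).injective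
  set D := (adicCompletionPrime K v).decompositionSubgroup (absoluteGaloisGroup K) with hDdef
  set res : absoluteGaloisGroup (v.adicCompletion K) →ₜ* absoluteGaloisGroup K :=
    absGaloisRestrict K (v.adicCompletion K) with hres
  have hrange : res.toMonoidHom.range = D := (decompositionSubgroup_adicCompletionPrime_eq_range K v).symm
  have hinj : Injective res.toMonoidHom := absGaloisRestrict_adicCompletion_injective K v
  -- the topological group isomorphism `ε : Γ_{K_v} ≃ D`
  let ε : absoluteGaloisGroup (v.adicCompletion K) ≃* D :=
    (MonoidHom.ofInjective hinj).trans (MulEquiv.subgroupCongr hrange)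
  have hε : ∀ x, ((ε x : D) : absoluteGaloisGroup K) = res x := fun _ => rfl
  have hε_cont : Continuous ε := by
    refine continuous_induced_rng.2 ?_
    have : (Subtype.val ∘ ε) = res := funext hε
    rw [this]
    exact res.continuous
  have hε_symm : Continuous ε.symm :=
    Continuous.continuous_symm_of_equiv_compact_to_t2 (f := ε.toEquiv) hε_cont
  -- read `β` in `ℤ/ℓ`
  have hchoice : ∀ x : AddCircle (1 : ℚ), ∃ k : ZMod ℓ, ℓ • x = 0 → e' k = x := fun x => by
    by_cases hx : ℓ • x = 0
    · obtain ⟨k, hk⟩ := he'surj x hx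
      exact ⟨k, fun _ => hk⟩
    · exact ⟨0, fun h => absurd h hx⟩
  choose h hh using hchoice
  set κ : absoluteGaloisGroup (v.adicCompletion K) → ZMod ℓ := fun x => h (β x) with hκ
  have hκβ : ∀ x, e' (κ x) = β x := fun x => hh (β x) (hβℓ x)
  have hκ_lc : IsLocallyConstant κ := hβ.comp h
  refine ⟨fun g => if hg : g ∈ D then κ (ε.symm ⟨g, hg⟩) else 0, ?_, fun a ha b hb => ?_⟩
  · have h1 : IsLocallyConstant (fun s : D => κ (ε.symm s)) := hκ_lc.comp_continuous hε_symm
    convert h1 using 1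
    ext s
    simp [s.2]
  · set x := ε.symm ⟨a, ha⟩ with hx
    set y := ε.symm ⟨b, hb⟩ with hy
    have hxa : res x = a := by rw [← hε, hx, MulEquiv.apply_symm_apply]
    have hyb : res y = b := by rw [← hε, hy, MulEquiv.apply_symm_apply]
    have hxy : ε.symm ⟨a * b, D.mul_mem ha hb⟩ = x * y := by
      apply ε.injective
      rw [MulEquiv.apply_symm_apply, map_mul, hx, hy, MulEquiv.apply_symm_apply,
        MulEquiv.apply_symm_apply]
      rfl
    simp only [dif_pos ha, dif_pos hb, dif_pos (D.mul_mem ha hb)]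
    rw [hxy]
    change f a b = κ x + κ y - κ (x * y)
    apply he'
    have key := hβf x y
    rw [hxa, hyb] at key
    rw [map_sub, map_add, hκβ, hκβ, hκβ]
    exact eq_sub_of_add_eq key

/-- **Finite support on the decomposition groups** ([NSW] (8.1.17)-style; Serre §6.5 (c) (i)): a
locally constant `ℤ/ℓ`-valued `2`-cocycle on `Γ_K`, `K` a number field, is an explicit coboundary on
`D_{𝔓₀(v)}` for all but finitely many finite places `v`.
[cite: NeukirchSchmidtWingberg2008, Prop (12.1.9)] -/
theorem eventually_coboundaryOn_decompositionSubgroup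
    (f : absoluteGaloisGroup K → absoluteGaloisGroup K → ZMod ℓ)
    (hlc : IsLocallyConstant (uncurry f))
    (hcoc : ∀ σ τ υ, f σ τ + f (σ * τ) υ = f τ υ + f σ (τ * υ)) :
    ∀ᶠ v : HeightOneSpectrum (𝓞 K) in Filter.cofinite,
      ∃ γ : absoluteGaloisGroup K → ZMod ℓ,
        IsLocallyConstant
          (fun s : ↥((adicCompletionPrime K v).decompositionSubgroup (absoluteGaloisGroup K)) => γ s) ∧
        ∀ a ∈ (adicCompletionPrime K v).decompositionSubgroup (absoluteGaloisGroup K),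
          ∀ b ∈ (adicCompletionPrime K v).decompositionSubgroup (absoluteGaloisGroup K),
            f a b = γ a + γ b - γ (a * b) := by
  obtain ⟨e', he', -, he'surj⟩ := zmod_exists_addMonoidHom_addCircle hℓ.out.pos
  -- the `(ℚ/ℤ)[ℓ]`-valued cocycle
  set g : absoluteGaloisGroup K → absoluteGaloisGroup K → AddCircle (1 : ℚ) := fun σ τ => e' (f σ τ)
    with hgdef
  have hg : IsLocallyConstant (uncurry g) := hlc.comp e'
  have hgcoc : ∀ σ τ υ, g σ τ + g (σ * τ) υ = g τ υ + g σ (τ * υ) := fun σ τ υ => by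
    simp only [hgdef, ← map_add, hcoc]
  have hgℓ : ∀ σ τ, ℓ • g σ τ = 0 := fun σ τ => by
    simp only [hgdef, ← map_nsmul, nsmul_eq_mul, ZMod.natCast_self, zero_mul, map_zero]
  filter_upwards [twoCocycle_nsmul_split_levelOne_eventually K hℓ.out.pos g hg hgcoc hgℓ] with v hv
  obtain ⟨β, hβ, hβg, hβℓ⟩ := hv
  exact coboundaryOn_decompositionSubgroup_of_split K v e' he' he'surj f β hβ hβg hβℓ

/-- **Finite support, set form**: the finite places `v` at which `f` fails to bound on `D_{𝔓₀(v)}`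
form a finite set. [cite: NeukirchSchmidtWingberg2008, Prop (12.1.9)] -/
theorem finite_setOf_not_coboundaryOn_decompositionSubgroup
    (f : absoluteGaloisGroup K → absoluteGaloisGroup K → ZMod ℓ)
    (hlc : IsLocallyConstant (uncurry f))
    (hcoc : ∀ σ τ υ, f σ τ + f (σ * τ) υ = f τ υ + f σ (τ * υ)) :
    Set.Finite {v : HeightOneSpectrum (𝓞 K) |
      ¬ ∃ γ : absoluteGaloisGroup K → ZMod ℓ,
        IsLocallyConstant
          (fun s : ↥((adicCompletionPrime K v).decompositionSubgroup (absoluteGaloisGroup K)) => γ s) ∧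
        ∀ a ∈ (adicCompletionPrime K v).decompositionSubgroup (absoluteGaloisGroup K),
          ∀ b ∈ (adicCompletionPrime K v).decompositionSubgroup (absoluteGaloisGroup K),
            f a b = γ a + γ b - γ (a * b)} :=
  (eventually_coboundaryOn_decompositionSubgroup K f hlc hcoc)

end Literature.NumberTheory.GaloisRepresentations.ExplicitMuCocycles

end
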